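import Literature.Geometry.Lorentzian.KerrRedShiftHorizon
import HarnessLib

/-!
# The bulk term of the red-shift multiplier OFF the horizon, exactly, in the horizon frame
# `(λ, v, q̸)` plus the axial component `p(Φ)`
(namespace `Literature.Geometry.Lorentzian.Kerr`.)

`KerrRedShiftBulk.lean` computes the bulk term `K^N` of the red-shift multiplier
`N = (1 + h₁(r − r₊))K + (1 + f₁(r − r₊))k` exactly at every point with `r > 0`
(`Kerr.multiplierBulk_redShiftVector`, in the null frame `u = p(m)`, `v = p(k)`, `g⁻¹(p, dr)`), and on the
horizon `r = r₊` rewrites it in the horizon frame `λ = p(K)`, `v`, `q̸ = (p + v dr)̸`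
(`Kerr.multiplierBulk_redShiftVector_of_radius_eq_rPlus`) using `dr♯ = 2HK` there. The propagation of
the horizon positivity to a collar is done in the tree by compactness (`Kerr.exists_redShift_bulk_coercive`),
which hides the dependence of the collar width and of the coercivity constant on the surface gravity
`κ`. This file supplies the exact identities needed for a `κ`-explicit propagation:

* `raisedDotRadius_eq_spatial` — **`dr♯` off the horizon**: for every covector `p` and `r > 0`,
  `g⁻¹(p, dr) = ((r² + a²)/Σ) p₀ + (a/Σ) p(Φ) − (Δ/Σ) v`, `p(Φ) = x₁p₂ − x₂p₁`, `Δ = r² − 2Mr + a²`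
  (i.e. `dr♯ = ((r² + a²)/Σ) ∂_{t*} + (a/Σ) Φ + (Δ/Σ) ℓ♯`: the ingoing-Kerr-coordinate formula
  `g^{rv} = (r² + a²)/Σ`, `g^{rφ} = a/Σ`, `g^{rr} = Δ/Σ`); with `λ = p₀ + ω₊ p(Φ)`:
  `g⁻¹(p, dr) = ((r² + a²)/Σ) λ − α p(Φ) − (Δ/Σ) v`, `α = ω₊(r² + a²)/Σ − a/Σ = a(r² − r₊²)/(Σ(r₊² + a²))`
  (`raisedDotRadius_eq_hawkingComp`), which at `r = r₊` is `dr♯ = 2HK`;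
* `frameOut_eq_raisedDotRadius` — `u = 2g⁻¹(p, dr) + (1 − 2H)v − 2 p̸·∇̸r`;
* `redShiftCoeff_eq` — the red-shift coefficient off the horizon:
  `(r/Σ)(1 − 2H) + (2r/Σ)|∇̸r|² + ∂_{ℓ♯}H = −(r − M)/Σ + 2rΔ/Σ²`;
* `multiplierBulk_redShiftVector_offHorizon` — **the bulk term in the horizon frame at every `r > 0`**:
  with `s = r − r₊`, `q̸ = (p + v dr)̸`, `A = q̸·∇̸r`, `E = p(Φ)`,
  `K^N = ((r² + a²)/Σ) h₁ λ² + ½ f₁ |q̸|² + (((1 + f₁s)(r − M) − ½ f₁Δ)/Σ) v²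
        − (h₁Δ/Σ + (1 + f₁s)·2r(r² + a²)/Σ²) λv + (1 + f₁s)(2r/Σ) vA − h₁ α λE + (1 + f₁s)(2r/Σ) α vE`.
  On the horizon (`s = Δ = α = 0`, `(r₊² + a²)/Σ = 2H`) this is the horizon form of the tree; off it, the
  `v²`-coefficient is `((r₊ − M) + s + ½f₁s²)/Σ ≥ (r₊ − M)/Σ` (NO loss: the dangerous `−½f₁Δ/Σ` is exactly
  compensated by the growth of `(1 + f₁s)(r − M)`), and the only new terms are the two `p(Φ)` cross terms
  of size `h₁s`, `s` — which is why a collar of width LINEAR in `κ` carries the red-shift when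
  `h₁ ≍ κ⁻¹` (sequel `KerrRedShiftCoercivityPoly.lean`).

## References
* M. Dafermos, I. Rodnianski, Y. Shlapentokh-Rothman, arXiv:1402.7034, §2.2.2, Prop. 4.5.1
  (key `DafermosRodnianskiShlapentokhrothman2014`).
* M. Dafermos, I. Rodnianski, arXiv:0811.0354, §3.3.2, Thm. 7.1 (key `DafermosRodnianski2008`).
* M. Visser, arXiv:0706.0622, (32)–(35) (key `arXiv07060622`).
-/

noncomputable section

open Set Filter
open scoped Topology

namespace Literature.Geometry.Lorentzian.Kerr

variable {M a : ℝ} {x : E4}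

/-! ### `dr♯` off the horizon -/

/-- **`g⁻¹(p, dr)` at every point with `r > 0`**:
`g⁻¹(p, dr) = ((r² + a²)/Σ) p₀ + (a/Σ)(x₁p₂ − x₂p₁) − (Δ/Σ) p(k)`, `Δ = r² − 2Mr + a²`. Componentwise:
`A^μ = η^{μμ}p_μ + 2Hvℓ^μ`, `ℓ♯(r) = 1`, `∂_{t*}r = 0`, and the spatial identity
`∇r = ((r² + a²)/Σ) ℓ⃗ + (a/Σ)(−x₂, x₁, 0)` (`∂₁r = rx₁/Σ`, `∂₂r = rx₂/Σ`, `∂₃r = (r² + a²)x₃/(rΣ)`,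
`ℓ⃗ = ((rx₁ + ax₂)/(r² + a²), (rx₂ − ax₁)/(r² + a²), x₃/r)`), with `ℓ⃗·p⃗ = p₀ − v` and `2H = 2Mr/Σ`.
This is `dr♯ = g^{rv}∂_v + g^{rφ}∂_φ + g^{rr}∂_r` of the ingoing Kerr coordinates read in the Kerr–Schild
chart. [cite: arXiv07060622, (35)] -/
theorem raisedDotRadius_eq_spatial (M a : ℝ) (hx : 0 < radius a x) (p : Fin 4 → ℝ) :
    raisedDotRadius M a x p =
      (radius a x ^ 2 + a ^ 2) / blSigma a (E4.spatial x) * p 0 +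
        a / blSigma a (E4.spatial x) * (x 1 * p 2 - x 2 * p 1) -
        (radius a x ^ 2 - 2 * M * radius a x + a ^ 2) / blSigma a (E4.spatial x) * frameIn a x p := by
  have hS := blSigma_spatial_pos hx
  have hQ : radius a x ^ 2 + a ^ 2 ≠ 0 := by positivity
  rw [raisedDotRadius]
  simp only [sum_inverseMetric_mul_eq]
  -- split off the term `2H v ∑_μ (ℓ♯)^μ ∂_μ r = 2H v`
  have hsplit : ∑ μ, ((if μ = 0 then -1 else 1) * p μ +
      2 * scalarH M a x * frameIn a x p * nullVector a x μ) * dRadius a x μ =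
      ∑ μ, (if μ = 0 then -1 else 1) * p μ * dRadius a x μ +
        2 * scalarH M a x * frameIn a x p * ∑ μ, nullVector a x μ * dRadius a x μ := by
    rw [Finset.mul_sum, ← Finset.sum_add_distrib]
    exact Finset.sum_congr rfl fun μ _ ↦ by ring
  rw [hsplit, sum_nullVector_mul_dRadius hx, mul_one]
  simp only [frameIn_eq, spatialDotNull_eq, Fin.sum_univ_four, Fin.isValue,
    dRadius_apply, fderiv_radius_basisVector_zero a hx, fderiv_radius_basisVector_one hx,
    fderiv_radius_basisVector_two hx, fderiv_radius_basisVector_three hx, nullCovectorFun_apply_one,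
    nullCovectorFun_apply_two, nullCovectorFun_apply_three, scalarH_eq_div_blSigma M a hx]
  simp only [show (1 : Fin 4) ≠ 0 from by decide, show (2 : Fin 4) ≠ 0 from by decide,
    show (3 : Fin 4) ≠ 0 from by decide, if_true, if_false]
  field_simp
  ring

/-- **`g⁻¹(p, dr)` in the horizon frame, off the horizon** (`|a| ≤ M`, `0 < M`, `r > 0`): with
`λ = p(K) = p₀ + ω₊(x₁p₂ − x₂p₁)`,
`g⁻¹(p, dr) = ((r² + a²)/Σ) λ − (ω₊(r² + a²)/Σ − a/Σ)(x₁p₂ − x₂p₁) − (Δ/Σ) v`;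
at `r = r₊` the middle coefficient vanishes (`ω₊ = a/(r₊² + a²)`) and `(r₊² + a²)/Σ = 2H`: `dr♯ = 2HK`
(`Kerr.raisedDotRadius_of_radius_eq_rPlus`). [cite: DafermosRodnianskiShlapentokhrothman2014, §2.2.2] -/
theorem raisedDotRadius_eq_hawkingComp (M a : ℝ) (hx : 0 < radius a x) (p : Fin 4 → ℝ) :
    raisedDotRadius M a x p =
      (radius a x ^ 2 + a ^ 2) / blSigma a (E4.spatial x) * hawkingComp M a x p -
        (horizonAngularVelocity M a * (radius a x ^ 2 + a ^ 2) / blSigma a (E4.spatial x) -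
          a / blSigma a (E4.spatial x)) * (x 1 * p 2 - x 2 * p 1) -
        (radius a x ^ 2 - 2 * M * radius a x + a ^ 2) / blSigma a (E4.spatial x) * frameIn a x p := by
  rw [raisedDotRadius_eq_spatial M a hx p, hawkingComp_eq]
  ring

/-- **`u = p(m)` in terms of `g⁻¹(p, dr)`**: `u = 2g⁻¹(p, dr) + (1 − 2H)v − 2 p̸·∇̸r`
(`Kerr.raisedDotRadius_eq_frame` solved for `u`). [folklore] -/
theorem frameOut_eq_raisedDotRadius (M a : ℝ) (hx : 0 < radius a x) (p : Fin 4 → ℝ) :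
    frameOut M a x p = 2 * raisedDotRadius M a x p + (1 - 2 * scalarH M a x) * frameIn a x p -
      2 * frameAng a x p (dRadius a x) := by
  have h := raisedDotRadius_eq_frame M a hx p
  linarith

/-- **The red-shift coefficient off the horizon**:
`(r/Σ)(1 − 2H) + (2r/Σ)|∇̸r|² + ∂_{ℓ♯}H = −(r − M)/Σ + 2rΔ/Σ²` (`2H = 2Mr/Σ`, `|∇̸r|² = (r² + a² − Σ)/Σ`,
`∂_{ℓ♯}H = M(Σ − 2r²)/Σ²`); at `r = r₊` this is `Kerr.redShiftCoeff_of_radius_eq_rPlus`.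
[cite: DafermosRodnianski2008, Thm. 7.1] -/
theorem redShiftCoeff_eq (M : ℝ) (hx : 0 < radius a x) :
    radius a x / blSigma a (E4.spatial x) * (1 - 2 * scalarH M a x) +
        2 * radius a x / blSigma a (E4.spatial x) * frameAngSq a x (dRadius a x) +
        fderiv ℝ (scalarH M a) x (nullVector a x) =
      -(radius a x - M) / blSigma a (E4.spatial x) +
        2 * radius a x * (radius a x ^ 2 - 2 * M * radius a x + a ^ 2) / blSigma a (E4.spatial x) ^ 2 := by
  have hS := blSigma_spatial_pos hx
  rw [fderiv_scalarH_nullVector M hx, frameAngSq_dRadius hx, scalarH_eq_div_blSigma M a hx]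
  field_simp
  ring

/-! ### The bulk term in the horizon frame at every `r > 0` -/

/-- **The bulk term of the red-shift multiplier in the horizon frame, off the horizon.** At a point
with `r > 0`, for every `w`, with `p = dw`, `λ = p(K)`, `v = p(k)`, `q = p + v dr` (`q̸` its angular
part, `A = q̸·∇̸r`), `E = x₁p₂ − x₂p₁ = p(Φ)`, `s = r − r₊`, `Δ = r² − 2Mr + a²`,
`α = ω₊(r² + a²)/Σ − a/Σ`:
`K^N = ((r² + a²)/Σ) h₁ λ² + ½ f₁ |q̸|² + (((1 + f₁s)(r − M) − ½f₁Δ)/Σ) v²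
      − (h₁Δ/Σ + (1 + f₁s)·2r(r² + a²)/Σ²) λ v + (1 + f₁s)(2r/Σ) v A − h₁ α λ E + (1 + f₁s)(2r/Σ) α v E`.
Proof: the exact bulk `Kerr.multiplierBulk_redShiftVector`, the square completion
`Kerr.raisedDotRadius_mul_frameIn_add`, `u` eliminated by `frameOut_eq_raisedDotRadius`, `g⁻¹(p, dr)`
by `raisedDotRadius_eq_hawkingComp`, and the coefficient identity `redShiftCoeff_eq`.
[cite: DafermosRodnianskiShlapentokhrothman2014, Prop. 4.5.1] -/
theorem multiplierBulk_redShiftVector_offHorizon (M a h₁ f₁ : ℝ) (hx : 0 < radius a x) (w : E4 → ℝ) :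
    KerrSchild.multiplierBulk (inverseMetric M a) (redShiftVector M a h₁ f₁) w x =
      (radius a x ^ 2 + a ^ 2) / blSigma a (E4.spatial x) * h₁ *
          hawkingComp M a x (fun μ ↦ fderiv ℝ w x (E4.basisVector μ)) ^ 2 +
        2⁻¹ * f₁ * frameAngSq a x ((fun μ ↦ fderiv ℝ w x (E4.basisVector μ)) +
          frameIn a x (fun μ ↦ fderiv ℝ w x (E4.basisVector μ)) • dRadius a x) +
        ((1 + f₁ * (radius a x - rPlus M a)) * (radius a x - M) -
            2⁻¹ * f₁ * (radius a x ^ 2 - 2 * M * radius a x + a ^ 2)) / blSigma a (E4.spatial x) *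
          frameIn a x (fun μ ↦ fderiv ℝ w x (E4.basisVector μ)) ^ 2 -
        (h₁ * (radius a x ^ 2 - 2 * M * radius a x + a ^ 2) / blSigma a (E4.spatial x) +
            (1 + f₁ * (radius a x - rPlus M a)) * (2 * radius a x * (radius a x ^ 2 + a ^ 2)) /
              blSigma a (E4.spatial x) ^ 2) *
          hawkingComp M a x (fun μ ↦ fderiv ℝ w x (E4.basisVector μ)) *
            frameIn a x (fun μ ↦ fderiv ℝ w x (E4.basisVector μ)) +
        (1 + f₁ * (radius a x - rPlus M a)) * (2 * radius a x / blSigma a (E4.spatial x)) *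
          frameIn a x (fun μ ↦ fderiv ℝ w x (E4.basisVector μ)) *
            frameAng a x ((fun μ ↦ fderiv ℝ w x (E4.basisVector μ)) +
              frameIn a x (fun μ ↦ fderiv ℝ w x (E4.basisVector μ)) • dRadius a x) (dRadius a x) -
        h₁ * (horizonAngularVelocity M a * (radius a x ^ 2 + a ^ 2) / blSigma a (E4.spatial x) -
            a / blSigma a (E4.spatial x)) *
          hawkingComp M a x (fun μ ↦ fderiv ℝ w x (E4.basisVector μ)) *
            (x 1 * fderiv ℝ w x (E4.basisVector 2) - x 2 * fderiv ℝ w x (E4.basisVector 1)) +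
        (1 + f₁ * (radius a x - rPlus M a)) * (2 * radius a x / blSigma a (E4.spatial x)) *
          (horizonAngularVelocity M a * (radius a x ^ 2 + a ^ 2) / blSigma a (E4.spatial x) -
            a / blSigma a (E4.spatial x)) *
          frameIn a x (fun μ ↦ fderiv ℝ w x (E4.basisVector μ)) *
            (x 1 * fderiv ℝ w x (E4.basisVector 2) - x 2 * fderiv ℝ w x (E4.basisVector 1)) := by
  have hS := blSigma_spatial_pos hx
  set p : Fin 4 → ℝ := fun μ ↦ fderiv ℝ w x (E4.basisVector μ) with hp_def
  have hp1 : fderiv ℝ w x (E4.basisVector 1) = p 1 := rfl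
  have hp2 : fderiv ℝ w x (E4.basisVector 2) = p 2 := rfl
  rw [hp1, hp2]
  have hcoef := redShiftCoeff_eq (a := a) (x := x) M hx
  rw [multiplierBulk_redShiftVector M a h₁ f₁ hx w, ← hp_def, raisedDotRadius_mul_frameIn_add M hx p,
    frameOut_eq_raisedDotRadius M a hx p, raisedDotRadius_eq_hawkingComp M a hx p,
    frameAng_add_smul_left, frameAng_self]
  rw [fderiv_scalarH_nullVector M hx, frameAngSq_dRadius hx, scalarH_eq_div_blSigma M a hx] at hcoef ⊢
  field_simp
  ring

end Literature.Geometry.Lorentzian.Kerr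

end
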